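import Literature.NumberTheory.LFunctions.Zhang2022.DetectorShiftClosedForm
import Literature.NumberTheory.LFunctions.Zhang2022.DetectorEntangledClampedGram

/-!
# Zhang (2022), programme F-S3 (cell landau-siegel §E, E-102 HEAD 1, piece R3c): the entangled block form in the
# DOUBLING vocabulary — `(π/2)·P^{dd}_b(g,h) = Re m₀(b)·T_b^{[0,1]}(S_g,S_h) + F_b(x_g,x_h)` for EVERY real triple,
# the summed form `(π/2)·m(a;b;h) = Σ_{j,l} [Re m₀^{jl}·T^{jl}(S_j,S_l) + F^{jl}(x_j,x_l)]`, and the SECOND-VARIATION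
# reduction of head 1 to jet extremals

Y. Zhang, *Discrete mean estimates and the Landau–Siegel zero*, arXiv:2211.02515v1 [Zhang2022LandauSiegel] —
an unrefereed manuscript under adjudication. **WHAT THIS IS NOT: not a claim about Theorems 1–2 of
arXiv:2211.02515, about Landau–Siegel zeros, or about Parity; nothing here asserts any claim of the manuscript.
The programme SEARCHES and TYPES; no claim about Landau–Siegel zeros, Theorems 1–2 of arXiv:2211.02515 or a
repaired Margin232 until a kernel theorem says so.** Seat ls-Bdet-typer-1 g4 (piece R3c = S-E-bt1-1, booked by
ls-barrier-plan g1 2026-08-27T03:00:04Z (c)); desk inputs: the seat's note `E102-LINEB-PARSEVAL-NOTE.md` §8 v3.2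
(b829bc3973c44e79), ls-theory g2 02:41:30Z (C) / 03:07:41Z (S1)–(S3), ls-barrier-p2 g4 `R3a-ENTDBL-p2.md` v1
(eb28893f166f1060) §1 (same objects: `Herm^{jl}` = `Det.bulkPolarOn`, `B^{jl}` = `2·Det.freeEndPolarDD`).

## What is here (all theorems are elementary calculus/algebra on the tree's objects; 0 named facts, 0 sorries)

Head 1 of E-102 (`Det.EdetCone`, `Det.ConePSD a b`: the block main-term form `m(a;b;h) = Det.entangledMain a b h h'`
is `≥ 0` on one-sided kinked profile vectors) was reduced by `DetectorEntangledClampedGram` (p487757/p489266) to the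
APEX-AND-MEAN-VANISHING SUB-CLASS (`h_j(0) = 0 = ∫h_j`), where it is a kernel theorem for every anchor `a ∈ (0,1]`.
What is left is the coupling of the `2K` boundary jets `x_j = (S_j(0), S_j′(0)) = (∫₀¹h_j, −h_j(0))` of the tail
primitives `S_j = ∫_y^1 h_j`. This file supplies the kernel IDENTITIES of that coupling, one level above the
one-profile DOUBLING route (`DetectorShiftClosedForm` [K1], `DetectorDoublingIdentity` [K2], `DetectorDoublingCompose` [K6]):

* **Part 1 — polar vocabulary.** `Det.bulkPolarOn b a c S S′ S″ T T′ T″ : ℂ`, the sesquilinear (Hermitian) bulk form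
  `∫_a^c [S″T̄″ + (iπe₁/2)(S′T̄″ − S″T̄′) + π²e₂·S′T̄′ − (iπ³e₃/2)(S′T̄ − S·T̄′)]` whose diagonal is K1's real
  `Det.bulkFormOn` (`bulkPolarOn_self`), and `Det.freeEndPolarDD b x₁ x₂ y₁ y₂ : ℂ`, the sesquilinear free-end form
  `−Im m₀·(−(πe₁/2)x₂ȳ₂ + (π³e₃/2)x₁ȳ₁) − π·Im m_s·x₂ȳ₂ + (π²/2)(m_n·x₂ȳ₁ + m̄_n·x₁ȳ₂)` written with the CONFLUENT
  dd-moments `Det.ddM0/ddMs/ddMn` (every real triple, repeats allowed — the diagonal blocks `j = l` of an entangled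
  design are repeated triples `(a, b_j, b_j)`); for an injective triple its diagonal is K1's `Det.freeEndForm`
  (`freeEndPolarDD_self_eq_freeEndForm`).
* **Part 2 — the block identity** (`formDetPolarDD_eq_bulkPolar_add_freeEndPolar`): for EVERY real triple `b` and
  one-sided kinked `g, h`,
  `(π/2)·FormDetPolarDD b g h = Re m₀(b)·bulkPolarOn b 0 1 (S_g,−g,−g′) (S_h,−h,−h′) + freeEndPolarDD b (∫g) (−g 0) (∫h) (−h 0)`
  — the polarisation of K1's `formDet_shiftRecipe_eq_bulk_add_freeEnd`, derived from the tree's three-moment collapse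
  `Det.formDetPolarDD_eq_collapse` by the `S ↔ g` dictionary (`S′ = −g`, `S″ = −g′`) and the two integrations by parts
  `Det.integral_deriv_mul_conj_add` and `Repair.integral_mul_conj_primitive_add`; the diagonal recovers K1
  (`formDetDD_eq_bulk_add_freeEnd_dd`).
* **Part 3 — the entangled (summed) form.** `Det.entangledPolar a b h k := Σ_{j,l} P^{dd}_{(a,b_j,b_l)}(h_j,k_l)`, the
  sesquilinear companion of `Det.entangledMain` (`entangledPolar_self`, `conj_entangledPolar`), additive in each slot
  on kinked profiles (`mformOf_add_smul_left/right` ⇒ `entangledPolar_add_smul_left/right`, `re_entangledMain_add`),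
  and the summed identity `(π/2)·entangledPolar = entangledBulk + entangledFreeEnd`
  (`entangledPolar_eq_bulk_add_freeEnd`, `entangledMain_eq_bulk_add_freeEnd`); on a sub-class test vector the free-end
  part drops (`entangledPolar_eq_bulk_of_subclass`), so the first variation of R3a is a pure bulk condition.
* **Part 4 — the second-variation reduction (theory's S3) as a kernel theorem.** If `h` and `s` are one-sided kinked
  profile vectors with the SAME JETS (`h_j(0) = s_j(0)`, `∫h_j = ∫s_j`) and `s` has vanishing first variation against
  the sub-class (`Re entangledPolar a b s k = 0` for every sub-class `k`), then for `a ∈ (0,1]`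
  `Re m(a;b;s) ≤ Re m(a;b;h)` (`re_entangledMain_ge_of_firstVariation`: `k = h − s` lies in the sub-class and
  `m(h) = m(s) + m(k) + 2Re P(s,k)` with `m(k) ≥ 0` by p489266). Consequently the interface one level above [K6]:
  `Det.conePSD_of_jetExtremals` — if for every jet datum there is such an `s` with `Re m(a;b;s) ≥ 0`, then
  `ConePSD a b` — and `Det.conePSD_iff_extremals_nonneg` (given extremals for all jets, head 1 at `(a,b)` ⟺ the
  extremals have non-negative energy: «`ConePSD a b ⟺ m(a;b) ⪰ 0`» of theory (C) with the extremal EXISTENCE (S1) and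
  the Euler–Lagrange property (S2) displayed as hypotheses — they are R3a's desk items, not asserted here).

**What is NOT here (honest).** No extremal is constructed (S1: jet surjectivity of the clamped-right Euler–Lagrange
system, expected ⟸ L-B′1 strict; S2: its first variation), no closed form of `m(a;b)`, and no sign statement: head 1
(`L-B′2′`: `m(a;b) ⪰ 0` for `a ∈ (0,1)`) stays OPEN-desk (certified PD on the ¼-grid census, ls-Bdet-num-2 kit j266480;
not a kernel statement). Nothing here asserts E-102 or any estimate.

References: Y. Zhang, arXiv:2211.02515v1 (2022), Prop 7.1 p.44 with (7.2), (7.19)–(7.21); §8 (8.11)–(8.23).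
[cite: Zhang2022LandauSiegel, Prop 7.1 p.44; §8 (8.11)–(8.23)]
-/

noncomputable section

open Complex Real Set intervalIntegral
open _root_.MeasureTheory
open scoped ComplexConjugate

namespace Literature.NumberTheory.LFunctions.Zhang2022

open Repair

namespace Det

/-! ### Part 1 — polar vocabulary: the sesquilinear bulk form and the sesquilinear free-end form -/

/-- **The POLAR bulk form `T_b^{[a,c]}(S,T)`** in tail-primitive variables (`S′, S″, T′, T″` supplied as data):
`∫_a^c [S″·conj T″ + (iπe₁/2)(S′·conj T″ − S″·conj T′) + π²e₂·S′·conj T′ − (iπ³e₃/2)(S′·conj T − S·conj T′)]`, `e_i` the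
elementary symmetric functions of `b`; Hermitian (`conj_bulkPolarOn`), diagonal = K1's `Det.bulkFormOn`
(`bulkPolarOn_self`). [cite: Zhang2022LandauSiegel, Prop 7.1 p.44 with (8.11)–(8.23)] -/
def bulkPolarOn (b : Fin 3 → ℝ) (a c : ℝ) (S S' S'' T T' T'' : ℝ → ℂ) : ℂ :=
  ∫ y in a..c, (S'' y * conj (T'' y)
    + I * ((π * (b 0 + b 1 + b 2) / 2 : ℝ) : ℂ) * (S' y * conj (T'' y) - S'' y * conj (T' y))
    + ((π ^ 2 * (b 0 * b 1 + b 1 * b 2 + b 2 * b 0) : ℝ) : ℂ) * (S' y * conj (T' y))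
    - I * ((π ^ 3 * (b 0 * b 1 * b 2) / 2 : ℝ) : ℂ) * (S' y * conj (T y) - S y * conj (T' y)))

/-- **The POLAR free-end form** of a real triple `b` (repeats allowed) in the jets `x = (S(0), S′(0))`, `y = (T(0), T′(0))`:
`−Im m₀·(−(πe₁/2)x₂ȳ₂ + (π³e₃/2)x₁ȳ₁) − π·Im m_s·x₂ȳ₂ + (π²/2)(m_n·x₂ȳ₁ + conj(m_n)·x₁ȳ₂)` with the confluent
dd-moments `m₀ = ddM0 b`, `m_s = ddMs b`, `m_n = ddMn b`; Hermitian (`conj_freeEndPolarDD`), diagonal = K1's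
`Det.freeEndForm` for an injective triple (`freeEndPolarDD_self_eq_freeEndForm`).
[cite: Zhang2022LandauSiegel, Prop 7.1 p.44 with (8.11)–(8.23)] -/
def freeEndPolarDD (b : Fin 3 → ℝ) (x₁ x₂ y₁ y₂ : ℂ) : ℂ :=
  -(((ddM0 b).im : ℝ) : ℂ) * (-((π * symE1 b / 2 : ℝ) : ℂ) * (x₂ * conj y₂) + ((π ^ 3 * symE3 b / 2 : ℝ) : ℂ) * (x₁ * conj y₁))
    - ((π * (ddMs b).im : ℝ) : ℂ) * (x₂ * conj y₂)
    + ((π ^ 2 / 2 : ℝ) : ℂ) * (ddMn b * (x₂ * conj y₁) + conj (ddMn b) * (x₁ * conj y₂))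

/-- `conj` commutes with the interval integral. [folklore] -/
private theorem conj_intervalIntegral (f : ℝ → ℂ) (a c : ℝ) :
    conj (∫ x in a..c, f x) = ∫ x in a..c, conj (f x) := by
  simp only [intervalIntegral, map_sub, integral_conj]

/-- `conj ⟨v,u⟩ = ⟨u,v⟩` (`⟨u,v⟩ = ∫₀¹ u·conj v`). [folklore] -/
private theorem conj_integral_mul_conj (u v : ℝ → ℂ) :
    conj (∫ x in (0:ℝ)..1, v x * conj (u x)) = ∫ x in (0:ℝ)..1, u x * conj (v x) := by
  rw [conj_intervalIntegral]
  refine intervalIntegral.integral_congr fun x _ => ?_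
  simp [mul_comm]

/-- **The polar bulk form is Hermitian:** `conj T(S,T) = T(T,S)`. [cite: Zhang2022LandauSiegel, Prop 7.1 p.44 with (8.11)–(8.23)] -/
theorem conj_bulkPolarOn (b : Fin 3 → ℝ) (a c : ℝ) (S S' S'' T T' T'' : ℝ → ℂ) :
    conj (bulkPolarOn b a c S S' S'' T T' T'') = bulkPolarOn b a c T T' T'' S S' S'' := by
  unfold bulkPolarOn
  rw [conj_intervalIntegral]
  refine intervalIntegral.integral_congr fun y _ => ?_
  simp only [map_add, map_sub, map_mul, Complex.conj_conj, Complex.conj_ofReal, Complex.conj_I]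
  ring

/-- **Diagonal of the polar bulk form = K1's bulk form:** `T(S,S) = bulkFormOn b a c S S′ S″` (as a complex number).
[cite: Zhang2022LandauSiegel, Prop 7.1 p.44 with (8.11)–(8.23)] -/
theorem bulkPolarOn_self (b : Fin 3 → ℝ) (a c : ℝ) (S S' S'' : ℝ → ℂ) :
    bulkPolarOn b a c S S' S'' S S' S'' = ((bulkFormOn b a c S S' S'' : ℝ) : ℂ) := by
  unfold bulkPolarOn bulkFormOn
  rw [← intervalIntegral.integral_ofReal]
  refine intervalIntegral.integral_congr fun y _ => ?_
  apply Complex.ext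
  · simp only [Complex.add_re, Complex.sub_re, Complex.mul_re, Complex.mul_im, Complex.sub_im,
      Complex.conj_re, Complex.conj_im, Complex.I_re, Complex.I_im, Complex.ofReal_re, Complex.ofReal_im,
      Complex.sq_norm, Complex.normSq_apply]
    ring
  · simp only [Complex.add_im, Complex.sub_im, Complex.mul_re, Complex.mul_im, Complex.sub_re,
      Complex.conj_re, Complex.conj_im, Complex.I_re, Complex.I_im, Complex.ofReal_re, Complex.ofReal_im]
    ring

/-- The diagonal of the polar bulk form is real. [cite: Zhang2022LandauSiegel, Prop 7.1 p.44 with (8.11)–(8.23)] -/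
theorem bulkPolarOn_self_re (b : Fin 3 → ℝ) (a c : ℝ) (S S' S'' : ℝ → ℂ) :
    (bulkPolarOn b a c S S' S'' S S' S'').re = bulkFormOn b a c S S' S'' := by
  rw [bulkPolarOn_self, Complex.ofReal_re]

/-- **The polar free-end form is Hermitian:** `conj F(x,y) = F(y,x)`. [cite: Zhang2022LandauSiegel, Prop 7.1 p.44 with (8.11)–(8.23)] -/
theorem conj_freeEndPolarDD (b : Fin 3 → ℝ) (x₁ x₂ y₁ y₂ : ℂ) :
    conj (freeEndPolarDD b x₁ x₂ y₁ y₂) = freeEndPolarDD b y₁ y₂ x₁ x₂ := by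
  unfold freeEndPolarDD
  simp only [map_add, map_sub, map_mul, map_neg, Complex.conj_conj, Complex.conj_ofReal]
  ring

/-- The diagonal of the polar free-end form is real. [cite: Zhang2022LandauSiegel, Prop 7.1 p.44 with (8.11)–(8.23)] -/
theorem freeEndPolarDD_self_im (b : Fin 3 → ℝ) (x₁ x₂ : ℂ) : (freeEndPolarDD b x₁ x₂ x₁ x₂).im = 0 := by
  have h := congrArg Complex.im (conj_freeEndPolarDD b x₁ x₂ x₁ x₂)
  rw [Complex.conj_im] at h
  linarith

/-- **Diagonal of the polar free-end form = K1's free-end form** for an injective triple (atoms = dd-moments there):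
`F(x,x) = freeEndForm b x₁ x₂` (via `Det.freeEndForm_eq_boundary`). [cite: Zhang2022LandauSiegel, Prop 7.1 p.44 with (8.11)–(8.23)] -/
theorem freeEndPolarDD_self_eq_freeEndForm {b : Fin 3 → ℝ} (hb : Function.Injective b) (x₁ x₂ : ℂ) :
    freeEndPolarDD b x₁ x₂ x₁ x₂ = ((freeEndForm b x₁ x₂ : ℝ) : ℂ) := by
  have hK1 := freeEndForm_eq_boundary hb x₁ (-x₂)
  rw [neg_neg, norm_neg] at hK1
  rw [hK1]
  unfold freeEndPolarDD
  have h1 : x₁ * conj x₁ = ((‖x₁‖ ^ 2 : ℝ) : ℂ) := by rw [Complex.mul_conj', Complex.ofReal_pow]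
  have h2 : x₂ * conj x₂ = ((‖x₂‖ ^ 2 : ℝ) : ℂ) := by rw [Complex.mul_conj', Complex.ofReal_pow]
  rw [h1, h2]
  apply Complex.ext
  · simp only [Complex.add_re, Complex.sub_re, Complex.neg_re, Complex.mul_re, Complex.mul_im, Complex.add_im,
      Complex.neg_im, Complex.conj_re, Complex.conj_im, Complex.ofReal_re, Complex.ofReal_im]
    ring
  · simp only [Complex.add_im, Complex.sub_im, Complex.neg_im, Complex.mul_re, Complex.mul_im, Complex.add_re,
      Complex.neg_re, Complex.conj_re, Complex.conj_im, Complex.ofReal_re, Complex.ofReal_im]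
    ring

/-- On a datum with `y = 0` the polar free-end form vanishes (the sub-class sees only the bulk).
[cite: Zhang2022LandauSiegel, Prop 7.1 p.44 with (7.2), (8.11)–(8.23)] -/
theorem freeEndPolarDD_zero_right (b : Fin 3 → ℝ) (x₁ x₂ : ℂ) : freeEndPolarDD b x₁ x₂ 0 0 = 0 := by
  simp [freeEndPolarDD]

/-- … and with `x = 0`. [cite: Zhang2022LandauSiegel, Prop 7.1 p.44 with (7.2), (8.11)–(8.23)] -/
theorem freeEndPolarDD_zero_left (b : Fin 3 → ℝ) (y₁ y₂ : ℂ) : freeEndPolarDD b 0 0 y₁ y₂ = 0 := by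
  simp [freeEndPolarDD]

/-! ### Part 2 — the block identity `(π/2)·P^{dd}_b(g,h) = Re m₀(b)·T_b^{[0,1]}(S_g,S_h) + F_b(x_g,x_h)` (every real triple) -/

section TwoProfiles

variable {b : Fin 3 → ℝ} {g g' h h' u u' f f' k k' : ℝ → ℂ}

/-- Linearity of `∫₀¹` over four weighted integrable terms. [folklore] -/
private theorem integral_lin4 {f1 f2 f3 f4 : ℝ → ℂ} (c1 c2 c3 c4 : ℂ)
    (h1 : IntervalIntegrable f1 volume 0 1) (h2 : IntervalIntegrable f2 volume 0 1)
    (h3 : IntervalIntegrable f3 volume 0 1) (h4 : IntervalIntegrable f4 volume 0 1) :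
    ∫ x in (0:ℝ)..1, (c1 * f1 x + c2 * f2 x + c3 * f3 x + c4 * f4 x)
      = c1 * (∫ x in (0:ℝ)..1, f1 x) + c2 * (∫ x in (0:ℝ)..1, f2 x)
        + c3 * (∫ x in (0:ℝ)..1, f3 x) + c4 * (∫ x in (0:ℝ)..1, f4 x) := by
  rw [intervalIntegral.integral_add (((h1.const_mul c1).add (h2.const_mul c2)).add (h3.const_mul c3))
      (h4.const_mul c4),
    intervalIntegral.integral_add ((h1.const_mul c1).add (h2.const_mul c2)) (h3.const_mul c3),
    intervalIntegral.integral_add (h1.const_mul c1) (h2.const_mul c2),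
    intervalIntegral.integral_const_mul, intervalIntegral.integral_const_mul,
    intervalIntegral.integral_const_mul, intervalIntegral.integral_const_mul]

/-- The six profile pairings of formula I are integrable on `[0,1]` for kinked profiles:
`g′·conj h′`, `g·conj h′`, `g′·conj h`, `g·conj h`, `g·conj S_h`, `S_g·conj h` (`S_u(x) = ∫₀ˣu`). [folklore] -/
private theorem pairings_integrable (hg : KinkedProfile g g') (hh : KinkedProfile h h') :
    IntervalIntegrable (fun x => g' x * conj (h' x)) volume 0 1
    ∧ IntervalIntegrable (fun x => g x * conj (h' x)) volume 0 1
    ∧ IntervalIntegrable (fun x => g' x * conj (h x)) volume 0 1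
    ∧ IntervalIntegrable (fun x => g x * conj (h x)) volume 0 1
    ∧ IntervalIntegrable (fun x => g x * conj (∫ t in (0:ℝ)..x, h t)) volume 0 1
    ∧ IntervalIntegrable (fun x => (∫ t in (0:ℝ)..x, g t) * conj (h x)) volume 0 1 := by
  have hG := hg.isH1
  have hH := hh.isH1
  refine ⟨hG.intervalIntegrable_deriv_mul_conj_deriv hH, ?_, hG.intervalIntegrable_deriv_mul_conj hH,
    hG.intervalIntegrable_mul_conj hH, hG.intervalIntegrable_mul_conj_primitive hH, ?_⟩
  · have hc : IntervalIntegrable (fun x => conj (h' x)) volume 0 1 := by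
      rw [intervalIntegrable_iff, uIoc_of_le zero_le_one]
      exact hH.memLp_conj.integrable one_le_two
    exact hc.continuousOn_mul (by rw [uIcc_of_le zero_le_one]; exact hg.cont)
  · exact ((continuousOn_primitive_unit hg.cont).mul (continuousOn_conj_comp hh.cont)).intervalIntegrable_of_Icc
      zero_le_one

/-- **The polar `S ↔ g` dictionary:** with `S = S_g`, `S′ = −g`, `S″ = −g′`, `T = S_h`, `T′ = −h`, `T″ = −h′` (tail
primitives `S_u = ∫_y^1 u` of kinked `g, h`),
`T_b^{[0,1]}(S_g,S_h) = ⟨g′,h′⟩ + (iπe₁/2)(⟨g,h′⟩ − ⟨g′,h⟩) + π²e₂⟨g,h⟩ − (iπ³e₃/2)(⟨g,P_h⟩ − ⟨P_g,h⟩)`,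
`⟨u,v⟩ = ∫₀¹u·conj v`, `P_u(x) = ∫₀ˣu` (the constant parts of `S_u = ∫₀¹u − P_u` cancel in the `e₃` term).
[cite: Zhang2022LandauSiegel, Prop 7.1 p.44 with (8.11)–(8.23)] -/
theorem bulkPolarOn_tailPrim (b : Fin 3 → ℝ) (hg : KinkedProfile g g') (hh : KinkedProfile h h') :
    bulkPolarOn b 0 1 (tailPrim g) (fun y => -g y) (fun y => -g' y) (tailPrim h) (fun y => -h y) (fun y => -h' y)
      = (∫ x in (0:ℝ)..1, g' x * conj (h' x))
        + I * ((π * symE1 b / 2 : ℝ) : ℂ)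
            * ((∫ x in (0:ℝ)..1, g x * conj (h' x)) - ∫ x in (0:ℝ)..1, g' x * conj (h x))
        + ((π ^ 2 * symE2 b : ℝ) : ℂ) * (∫ x in (0:ℝ)..1, g x * conj (h x))
        - I * ((π ^ 3 * symE3 b / 2 : ℝ) : ℂ)
            * ((∫ x in (0:ℝ)..1, g x * conj (∫ t in (0:ℝ)..x, h t))
              - ∫ x in (0:ℝ)..1, (∫ t in (0:ℝ)..x, g t) * conj (h x)) := by
  obtain ⟨i1, i2, i3, i4, i6, i8⟩ := pairings_integrable hg hh
  have hgi : IntervalIntegrable g volume 0 1 := hg.cont.intervalIntegrable_of_Icc zero_le_one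
  have hhi : IntervalIntegrable h volume 0 1 := hh.cont.intervalIntegrable_of_Icc zero_le_one
  have i5 : IntervalIntegrable (fun x => g x * conj (∫ t in (0:ℝ)..1, h t)) volume 0 1 := hgi.mul_const _
  have i7 : IntervalIntegrable (fun x => (∫ t in (0:ℝ)..1, g t) * conj (h x)) volume 0 1 :=
    ((continuousOn_conj_comp hh.cont).intervalIntegrable_of_Icc zero_le_one).const_mul _
  set r1 : ℂ := ((π * symE1 b / 2 : ℝ) : ℂ) with hr1
  set r2 : ℂ := ((π ^ 2 * symE2 b : ℝ) : ℂ) with hr2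
  set r3 : ℂ := ((π ^ 3 * symE3 b / 2 : ℝ) : ℂ) with hr3
  have hpt : ∀ y ∈ uIcc (0:ℝ) 1,
      ((-g' y) * conj (-h' y)
        + I * ((π * (b 0 + b 1 + b 2) / 2 : ℝ) : ℂ) * ((-g y) * conj (-h' y) - (-g' y) * conj (-h y))
        + ((π ^ 2 * (b 0 * b 1 + b 1 * b 2 + b 2 * b 0) : ℝ) : ℂ) * ((-g y) * conj (-h y))
        - I * ((π ^ 3 * (b 0 * b 1 * b 2) / 2 : ℝ) : ℂ) * ((-g y) * conj (tailPrim h y) - tailPrim g y * conj (-h y)))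
      = (1 * (g' y * conj (h' y)) + (I * r1) * (g y * conj (h' y)) + (-(I * r1)) * (g' y * conj (h y))
          + r2 * (g y * conj (h y)))
        + ((I * r3) * (g y * conj (∫ t in (0:ℝ)..1, h t)) + (-(I * r3)) * (g y * conj (∫ t in (0:ℝ)..y, h t))
          + (-(I * r3)) * ((∫ t in (0:ℝ)..1, g t) * conj (h y))
          + (I * r3) * ((∫ t in (0:ℝ)..y, g t) * conj (h y))) := by
    intro y hy
    rw [uIcc_of_le zero_le_one] at hy
    rw [tailPrim_eq_sub hgi hy, tailPrim_eq_sub hhi hy, map_sub]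
    simp only [map_neg, hr1, hr2, hr3, symE1, symE2, symE3]
    push_cast
    ring
  unfold bulkPolarOn
  rw [intervalIntegral.integral_congr hpt]
  have iA := (((i1.const_mul 1).add (i2.const_mul (I * r1))).add (i3.const_mul (-(I * r1)))).add (i4.const_mul r2)
  have iB := (((i5.const_mul (I * r3)).add (i6.const_mul (-(I * r3)))).add (i7.const_mul (-(I * r3)))).add
    (i8.const_mul (I * r3))
  rw [intervalIntegral.integral_add iA iB, integral_lin4 _ _ _ _ i1 i2 i3 i4, integral_lin4 _ _ _ _ i5 i6 i7 i8,
    intervalIntegral.integral_mul_const, intervalIntegral.integral_const_mul, ← conj_intervalIntegral]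
  ring

/-- `conj Q_e(h,g)` in the pairings of `(g,h)`: `⟨g′,h′⟩ − iπe₁⟨g′,h⟩ + π²e₂⟨g,h⟩ − iπ³e₃(∫g·conj∫h − ⟨P_g,h⟩)`.
[cite: Zhang2022LandauSiegel, Prop 7.1 p.44, (8.11)–(8.12)] -/
private theorem conj_shiftCore_swap (e1 e2 e3 : ℝ) (g g' h h' : ℝ → ℂ) :
    conj (shiftCore e1 e2 e3 h h' g g')
      = (∫ x in (0:ℝ)..1, g' x * conj (h' x))
        - I * π * (e1 : ℂ) * (∫ x in (0:ℝ)..1, g' x * conj (h x))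
        + (π : ℂ) ^ 2 * (e2 : ℂ) * (∫ x in (0:ℝ)..1, g x * conj (h x))
        - I * (π : ℂ) ^ 3 * (e3 : ℂ) * ((∫ x in (0:ℝ)..1, g x) * conj (∫ x in (0:ℝ)..1, h x)
            - ∫ x in (0:ℝ)..1, (∫ t in (0:ℝ)..x, g t) * conj (h x)) := by
  unfold shiftCore
  simp only [map_add, map_sub, map_mul, map_pow, Complex.conj_conj, Complex.conj_ofReal, Complex.conj_I,
    conj_integral_mul_conj]
  ring

/-- `(π/2)·P^{dd}` as half the sum of the two collapsed one-sided formula-I terms.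
[cite: Zhang2022LandauSiegel, Prop 7.1 p.44, (7.2), (8.11)–(8.12)] -/
private theorem half_pi_mul_formDetPolarDD (b : Fin 3 → ℝ) (hg : KinkedProfile g g') (hh : KinkedProfile h h')
    (hg1 : g 1 = 0) (hh1 : h 1 = 0) :
    ((π / 2 : ℝ) : ℂ) * FormDetPolarDD b g g' h h'
      = (1 / 2 : ℂ) * (ddM0 b * shiftCore (symE1 b) (symE2 b) (symE3 b) g g' h h'
            + I * π * (ddMs b * (g 0 * conj (h 0)))
            - (π : ℂ) ^ 2 * (ddMn b * (g 0 * conj (∫ x in (0:ℝ)..1, h x))))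
        + (1 / 2 : ℂ) * conj (ddM0 b * shiftCore (symE1 b) (symE2 b) (symE3 b) h h' g g'
            + I * π * (ddMs b * (h 0 * conj (g 0)))
            - (π : ℂ) ^ 2 * (ddMn b * (h 0 * conj (∫ x in (0:ℝ)..1, g x)))) := by
  rw [formDetPolarDD_eq_collapse b hg hh hg1 hh1, map_mul, Complex.conj_ofReal]
  have hπ : (π : ℂ) ≠ 0 := by exact_mod_cast Real.pi_ne_zero
  push_cast
  field_simp

/-- **THE BLOCK IDENTITY (R3c), every real triple, repeats allowed:** for one-sided kinked `g, h` (`g(1) = h(1) = 0`),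
with tail primitives `S_g, S_h` and jets `x_g = (S_g(0), S_g′(0)) = (∫₀¹g, −g(0))`, `x_h` likewise,
`(π/2)·P^{dd}_b(g,h) = Re m₀(b)·T_b^{[0,1]}(S_g,S_h) + F_b(x_g,x_h)` — the polarisation of K1's
`Det.formDet_shiftRecipe_eq_bulk_add_freeEnd`, in confluent dd-moments. (From `Det.formDetPolarDD_eq_collapse`: the
Hermitian part of `Q_b` is the polar bulk form, its anti-Hermitian part and the two apex terms are the boundary data,
by `Det.integral_deriv_mul_conj_add` and `Repair.integral_mul_conj_primitive_add`.)
[cite: Zhang2022LandauSiegel, Prop 7.1 p.44 with (7.2), (8.11)–(8.23)] -/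
theorem formDetPolarDD_eq_bulkPolar_add_freeEndPolar (b : Fin 3 → ℝ) (hg : KinkedProfile g g')
    (hh : KinkedProfile h h') (hg1 : g 1 = 0) (hh1 : h 1 = 0) :
    ((π / 2 : ℝ) : ℂ) * FormDetPolarDD b g g' h h'
      = (((ddM0 b).re : ℝ) : ℂ)
          * bulkPolarOn b 0 1 (tailPrim g) (fun y => -g y) (fun y => -g' y) (tailPrim h) (fun y => -h y) (fun y => -h' y)
        + freeEndPolarDD b (∫ x in (0:ℝ)..1, g x) (-g 0) (∫ x in (0:ℝ)..1, h x) (-h 0) := by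
  have R1 := integral_deriv_mul_conj_add_oneSided hg hh hg1
  have R2 := integral_mul_conj_primitive_add hg.cont hh.cont
  have hre : (((ddM0 b).re : ℝ) : ℂ) = (ddM0 b + conj (ddM0 b)) / 2 := Complex.re_eq_add_conj _
  have him0 : (((ddM0 b).im : ℝ) : ℂ) = I * (conj (ddM0 b) - ddM0 b) / 2 := by
    rw [← neg_sub, Complex.sub_conj]
    push_cast
    linear_combination (((ddM0 b).im : ℝ) : ℂ) * Complex.I_mul_I
  have hims : ((π * (ddMs b).im : ℝ) : ℂ) = (π : ℂ) * (I * (conj (ddMs b) - ddMs b) / 2) := by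
    rw [← neg_sub, Complex.sub_conj]
    push_cast
    linear_combination ((π : ℂ) * (((ddMs b).im : ℝ) : ℂ)) * Complex.I_mul_I
  unfold freeEndPolarDD
  rw [hre, him0, hims, half_pi_mul_formDetPolarDD b hg hh hg1 hh1, bulkPolarOn_tailPrim b hg hh]
  simp only [map_add, map_sub, map_mul, map_neg, map_pow, Complex.conj_conj, Complex.conj_ofReal, Complex.conj_I,
    conj_shiftCore_swap]
  unfold shiftCore
  push_cast
  linear_combination (I * π * (symE1 b : ℂ) * (ddM0 b - conj (ddM0 b)) / 4) * R1
    + (-(I * (π : ℂ) ^ 3 * (symE3 b : ℂ) * (ddM0 b - conj (ddM0 b)) / 4)) * R2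

/-- **The diagonal, every real triple (repeats allowed):** `(π/2)·𝔅^{dd}_b(g) = Re m₀(b)·T_b^{[0,1]}(S_g) + Re F_b(x_g,x_g)`
— K1's closed form `Det.formDet_shiftRecipe_eq_bulk_add_freeEnd` extended to confluent triples (for an injective
triple `Re F_b(x,x) = freeEndForm b x₁ x₂`, `freeEndPolarDD_self_eq_freeEndForm`).
[cite: Zhang2022LandauSiegel, Prop 7.1 p.44 with (7.2), (8.11)–(8.23)] -/
theorem formDetDD_eq_bulk_add_freeEnd_dd (b : Fin 3 → ℝ) (hg : KinkedProfile g g') (hg1 : g 1 = 0) :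
    π / 2 * FormDetDD b g g'
      = (ddM0 b).re * bulkFormOn b 0 1 (tailPrim g) (fun y => -g y) (fun y => -g' y)
        + (freeEndPolarDD b (∫ x in (0:ℝ)..1, g x) (-g 0) (∫ x in (0:ℝ)..1, g x) (-g 0)).re := by
  have h := congrArg Complex.re (formDetPolarDD_eq_bulkPolar_add_freeEndPolar b hg hg hg1 hg1)
  rw [Complex.re_ofReal_mul, formDetPolarDD_self_re, Complex.add_re, Complex.re_ofReal_mul, bulkPolarOn_self_re] at h
  exact h

/-! ### Part 3 — sesquilinearity on kinked profiles and the entangled (summed) form -/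

/-- **Formula I with free moments is additive-homogeneous in the LEFT profile** on kinked profiles:
`M(u + t·f; h) = M(u;h) + t·M(f;h)`. [cite: Zhang2022LandauSiegel, Prop 7.1 p.44, (8.11)–(8.12)] -/
theorem mformOf_add_smul_left (m0 ms mn mb mbs mbn t : ℂ) (hu : KinkedProfile u u') (hf : KinkedProfile f f')
    (hh : KinkedProfile h h') :
    MformOf m0 ms mn mb mbs mbn (fun x => u x + t * f x) (fun x => u' x + t * f' x) h h'
      = MformOf m0 ms mn mb mbs mbn u u' h h' + t * MformOf m0 ms mn mb mbs mbn f f' h h' := by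
  obtain ⟨u1, u2, u3, u4, u6, -⟩ := pairings_integrable hu hh
  obtain ⟨f1, f2, f3, f4, f6, -⟩ := pairings_integrable hf hh
  have hui : IntervalIntegrable u volume 0 1 := hu.cont.intervalIntegrable_of_Icc zero_le_one
  have hfi : IntervalIntegrable f volume 0 1 := hf.cont.intervalIntegrable_of_Icc zero_le_one
  have e1 : (∫ x in (0:ℝ)..1, (u' x + t * f' x) * conj (h' x))
      = (∫ x in (0:ℝ)..1, u' x * conj (h' x)) + t * ∫ x in (0:ℝ)..1, f' x * conj (h' x) := by
    rw [← intervalIntegral.integral_const_mul, ← intervalIntegral.integral_add u1 (f1.const_mul t)]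
    exact intervalIntegral.integral_congr fun x _ => by ring
  have e2 : (∫ x in (0:ℝ)..1, (u' x + t * f' x) * conj (h x))
      = (∫ x in (0:ℝ)..1, u' x * conj (h x)) + t * ∫ x in (0:ℝ)..1, f' x * conj (h x) := by
    rw [← intervalIntegral.integral_const_mul, ← intervalIntegral.integral_add u3 (f3.const_mul t)]
    exact intervalIntegral.integral_congr fun x _ => by ring
  have e3 : (∫ x in (0:ℝ)..1, (u x + t * f x) * conj (h' x))
      = (∫ x in (0:ℝ)..1, u x * conj (h' x)) + t * ∫ x in (0:ℝ)..1, f x * conj (h' x) := by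
    rw [← intervalIntegral.integral_const_mul, ← intervalIntegral.integral_add u2 (f2.const_mul t)]
    exact intervalIntegral.integral_congr fun x _ => by ring
  have e4 : (∫ x in (0:ℝ)..1, (u x + t * f x) * conj (h x))
      = (∫ x in (0:ℝ)..1, u x * conj (h x)) + t * ∫ x in (0:ℝ)..1, f x * conj (h x) := by
    rw [← intervalIntegral.integral_const_mul, ← intervalIntegral.integral_add u4 (f4.const_mul t)]
    exact intervalIntegral.integral_congr fun x _ => by ring
  have e5 : (∫ x in (0:ℝ)..1, (u x + t * f x)) = (∫ x in (0:ℝ)..1, u x) + t * ∫ x in (0:ℝ)..1, f x := by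
    rw [← intervalIntegral.integral_const_mul, ← intervalIntegral.integral_add hui (hfi.const_mul t)]
  have e6 : (∫ x in (0:ℝ)..1, (u x + t * f x) * conj (∫ s in (0:ℝ)..x, h s))
      = (∫ x in (0:ℝ)..1, u x * conj (∫ s in (0:ℝ)..x, h s)) + t * ∫ x in (0:ℝ)..1, f x * conj (∫ s in (0:ℝ)..x, h s) := by
    rw [← intervalIntegral.integral_const_mul, ← intervalIntegral.integral_add u6 (f6.const_mul t)]
    exact intervalIntegral.integral_congr fun x _ => by ring
  unfold MformOf
  rw [e1, e2, e3, e4, e5, e6]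
  ring

/-- **… and conjugate-additive-homogeneous in the RIGHT profile:** `M(u; h + t·k) = M(u;h) + conj t·M(u;k)`.
[cite: Zhang2022LandauSiegel, Prop 7.1 p.44, (8.11)–(8.12)] -/
theorem mformOf_add_smul_right (m0 ms mn mb mbs mbn t : ℂ) (hu : KinkedProfile u u') (hh : KinkedProfile h h')
    (hk : KinkedProfile k k') :
    MformOf m0 ms mn mb mbs mbn u u' (fun x => h x + t * k x) (fun x => h' x + t * k' x)
      = MformOf m0 ms mn mb mbs mbn u u' h h' + conj t * MformOf m0 ms mn mb mbs mbn u u' k k' := by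
  obtain ⟨h1, h2, h3, h4, h6, -⟩ := pairings_integrable hu hh
  obtain ⟨k1, k2, k3, k4, k6, -⟩ := pairings_integrable hu hk
  have hhi : IntervalIntegrable h volume 0 1 := hh.cont.intervalIntegrable_of_Icc zero_le_one
  have hki : IntervalIntegrable k volume 0 1 := hk.cont.intervalIntegrable_of_Icc zero_le_one
  have e1 : (∫ x in (0:ℝ)..1, u' x * conj (h' x + t * k' x))
      = (∫ x in (0:ℝ)..1, u' x * conj (h' x)) + conj t * ∫ x in (0:ℝ)..1, u' x * conj (k' x) := by
    rw [← intervalIntegral.integral_const_mul, ← intervalIntegral.integral_add h1 (k1.const_mul (conj t))]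
    exact intervalIntegral.integral_congr fun x _ => by simp only [map_add, map_mul]; ring
  have e2 : (∫ x in (0:ℝ)..1, u' x * conj (h x + t * k x))
      = (∫ x in (0:ℝ)..1, u' x * conj (h x)) + conj t * ∫ x in (0:ℝ)..1, u' x * conj (k x) := by
    rw [← intervalIntegral.integral_const_mul, ← intervalIntegral.integral_add h3 (k3.const_mul (conj t))]
    exact intervalIntegral.integral_congr fun x _ => by simp only [map_add, map_mul]; ring
  have e3 : (∫ x in (0:ℝ)..1, u x * conj (h' x + t * k' x))
      = (∫ x in (0:ℝ)..1, u x * conj (h' x)) + conj t * ∫ x in (0:ℝ)..1, u x * conj (k' x) := by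
    rw [← intervalIntegral.integral_const_mul, ← intervalIntegral.integral_add h2 (k2.const_mul (conj t))]
    exact intervalIntegral.integral_congr fun x _ => by simp only [map_add, map_mul]; ring
  have e4 : (∫ x in (0:ℝ)..1, u x * conj (h x + t * k x))
      = (∫ x in (0:ℝ)..1, u x * conj (h x)) + conj t * ∫ x in (0:ℝ)..1, u x * conj (k x) := by
    rw [← intervalIntegral.integral_const_mul, ← intervalIntegral.integral_add h4 (k4.const_mul (conj t))]
    exact intervalIntegral.integral_congr fun x _ => by simp only [map_add, map_mul]; ring
  have e5 : (∫ x in (0:ℝ)..1, (h x + t * k x)) = (∫ x in (0:ℝ)..1, h x) + t * ∫ x in (0:ℝ)..1, k x := by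
    rw [← intervalIntegral.integral_const_mul, ← intervalIntegral.integral_add hhi (hki.const_mul t)]
  have e6 : (∫ x in (0:ℝ)..1, u x * conj (∫ s in (0:ℝ)..x, (h s + t * k s)))
      = (∫ x in (0:ℝ)..1, u x * conj (∫ s in (0:ℝ)..x, h s)) + conj t * ∫ x in (0:ℝ)..1, u x * conj (∫ s in (0:ℝ)..x, k s) := by
    rw [← intervalIntegral.integral_const_mul, ← intervalIntegral.integral_add h6 (k6.const_mul (conj t))]
    refine intervalIntegral.integral_congr fun x hx => ?_
    rw [uIcc_of_le zero_le_one] at hx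
    simp only [hh.isH1.primitive_add_smul hk.isH1 t hx, map_add, map_mul]
    ring
  unfold MformOf
  rw [e1, e2, e3, e4, e5, e6]
  simp only [map_add, map_mul]
  ring

/-- **The polar block is linear in the left profile** (kinked profiles): `P(u + t·f, h) = P(u,h) + t·P(f,h)`.
[cite: Zhang2022LandauSiegel, Prop 7.1 p.44, (8.11)–(8.12)] -/
theorem formDetPolarDD_add_smul_left (b : Fin 3 → ℝ) (t : ℂ) (hu : KinkedProfile u u') (hf : KinkedProfile f f')
    (hh : KinkedProfile h h') :
    FormDetPolarDD b (fun x => u x + t * f x) (fun x => u' x + t * f' x) h h'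
      = FormDetPolarDD b u u' h h' + t * FormDetPolarDD b f f' h h' := by
  rw [FormDetPolarDD, FormDetPolarDD, FormDetPolarDD, MformDD, MformDD, MformDD, MformDD, MformDD, MformDD,
    mformOf_add_smul_left _ _ _ _ _ _ t hu hf hh, mformOf_add_smul_right _ _ _ _ _ _ t hh hu hf]
  simp only [map_add, map_mul, Complex.conj_conj]
  ring

/-- **… and conjugate-linear in the right profile:** `P(u, h + t·k) = P(u,h) + conj t·P(u,k)`.
[cite: Zhang2022LandauSiegel, Prop 7.1 p.44, (8.11)–(8.12)] -/
theorem formDetPolarDD_add_smul_right (b : Fin 3 → ℝ) (t : ℂ) (hu : KinkedProfile u u') (hh : KinkedProfile h h')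
    (hk : KinkedProfile k k') :
    FormDetPolarDD b u u' (fun x => h x + t * k x) (fun x => h' x + t * k' x)
      = FormDetPolarDD b u u' h h' + conj t * FormDetPolarDD b u u' k k' := by
  rw [FormDetPolarDD, FormDetPolarDD, FormDetPolarDD, MformDD, MformDD, MformDD, MformDD, MformDD, MformDD,
    mformOf_add_smul_right _ _ _ _ _ _ t hu hh hk, mformOf_add_smul_left _ _ _ _ _ _ t hh hk hu]
  simp only [map_add, map_mul]
  ring

end TwoProfiles

section Entangled

variable {K : ℕ} {a : ℝ} {b : Fin K → ℝ} {h h' k k' s s' : Fin K → ℝ → ℂ}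

/-- **The sesquilinear entangled form `P(a;b)(h,k) = Σ_j Σ_l P^{dd}_{(a,b_j,b_l)}(h_j,k_l)`** — the polarisation of
the block main-term form `Det.entangledMain` (`entangledPolar_self`). Design data; nothing asserted.
[cite: Zhang2022LandauSiegel, Prop 7.1 p.44, (7.19)–(7.21), (8.11)–(8.12)] -/
def entangledPolar (a : ℝ) {K : ℕ} (b : Fin K → ℝ) (h h' k k' : Fin K → ℝ → ℂ) : ℂ :=
  ∑ j, ∑ l, FormDetPolarDD ![a, b j, b l] (h j) (h' j) (k l) (k' l)

/-- `P(h,h) = m(a;b;h)`. [cite: Zhang2022LandauSiegel, Prop 7.1 p.44, (8.11)–(8.12)] -/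
theorem entangledPolar_self (a : ℝ) (b : Fin K → ℝ) (h h' : Fin K → ℝ → ℂ) :
    entangledPolar a b h h' h h' = entangledMain a b h h' := rfl

/-- **Hermitian symmetry:** `conj P(h,k) = P(k,h)` (Hermitian blocks, symmetric dd-moments, `Σ_{j,l} = Σ_{l,j}`).
[cite: Zhang2022LandauSiegel, Prop 7.1 p.44, (8.11)–(8.12)] -/
theorem conj_entangledPolar (a : ℝ) (b : Fin K → ℝ) (h h' k k' : Fin K → ℝ → ℂ) :
    conj (entangledPolar a b h h' k k') = entangledPolar a b k k' h h' := by
  rw [entangledPolar, entangledPolar, map_sum, Finset.sum_comm]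
  refine Finset.sum_congr rfl fun l _ => ?_
  rw [map_sum]
  refine Finset.sum_congr rfl fun j _ => ?_
  rw [formDetPolarDD_conj, formDetPolarDD_swap a (b j) (b l)]

/-- `Re P(k,h) = Re P(h,k)`. [cite: Zhang2022LandauSiegel, Prop 7.1 p.44, (8.11)–(8.12)] -/
theorem re_entangledPolar_swap (a : ℝ) (b : Fin K → ℝ) (h h' k k' : Fin K → ℝ → ℂ) :
    (entangledPolar a b k k' h h').re = (entangledPolar a b h h' k k').re := by
  rw [← conj_entangledPolar, Complex.conj_re]

/-- **Linearity in the left profile vector** (kinked profiles): `P(u + t·f, k) = P(u,k) + t·P(f,k)`.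
[cite: Zhang2022LandauSiegel, Prop 7.1 p.44, (8.11)–(8.12)] -/
theorem entangledPolar_add_smul_left (a : ℝ) (b : Fin K → ℝ) (t : ℂ) {u u' f f' : Fin K → ℝ → ℂ}
    (hu : ∀ j, KinkedProfile (u j) (u' j)) (hf : ∀ j, KinkedProfile (f j) (f' j))
    (hk : ∀ j, KinkedProfile (k j) (k' j)) :
    entangledPolar a b (fun j x => u j x + t * f j x) (fun j x => u' j x + t * f' j x) k k'
      = entangledPolar a b u u' k k' + t * entangledPolar a b f f' k k' := by
  unfold entangledPolar
  rw [Finset.mul_sum, ← Finset.sum_add_distrib]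
  refine Finset.sum_congr rfl fun j _ => ?_
  rw [Finset.mul_sum, ← Finset.sum_add_distrib]
  refine Finset.sum_congr rfl fun l _ => ?_
  exact formDetPolarDD_add_smul_left _ t (hu j) (hf j) (hk l)

/-- **Conjugate-linearity in the right profile vector:** `P(h, u + t·f) = P(h,u) + conj t·P(h,f)`.
[cite: Zhang2022LandauSiegel, Prop 7.1 p.44, (8.11)–(8.12)] -/
theorem entangledPolar_add_smul_right (a : ℝ) (b : Fin K → ℝ) (t : ℂ) {u u' f f' : Fin K → ℝ → ℂ}
    (hh : ∀ j, KinkedProfile (h j) (h' j)) (hu : ∀ j, KinkedProfile (u j) (u' j))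
    (hf : ∀ j, KinkedProfile (f j) (f' j)) :
    entangledPolar a b h h' (fun j x => u j x + t * f j x) (fun j x => u' j x + t * f' j x)
      = entangledPolar a b h h' u u' + conj t * entangledPolar a b h h' f f' := by
  unfold entangledPolar
  rw [Finset.mul_sum, ← Finset.sum_add_distrib]
  refine Finset.sum_congr rfl fun j _ => ?_
  rw [Finset.mul_sum, ← Finset.sum_add_distrib]
  refine Finset.sum_congr rfl fun l _ => ?_
  exact formDetPolarDD_add_smul_right _ t (hh j) (hu l) (hf l)

/-- **Second-variation expansion of the block form:** for kinked profile vectors `u, f`,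
`m(a;b;u+f) = m(u) + m(f) + P(u,f) + P(f,u)`, hence `Re m(u+f) = Re m(u) + Re m(f) + 2·Re P(u,f)`.
[cite: Zhang2022LandauSiegel, Prop 7.1 p.44, (8.11)–(8.12)] -/
theorem entangledMain_add {u u' f f' : Fin K → ℝ → ℂ} (hu : ∀ j, KinkedProfile (u j) (u' j))
    (hf : ∀ j, KinkedProfile (f j) (f' j)) :
    entangledMain a b (fun j x => u j x + f j x) (fun j x => u' j x + f' j x)
      = entangledMain a b u u' + entangledMain a b f f' + entangledPolar a b u u' f f' + entangledPolar a b f f' u u' := by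
  have hL := entangledPolar_add_smul_left a b 1 hu hf (k := fun j x => u j x + f j x) (k' := fun j x => u' j x + f' j x)
    (fun j => by simpa using (hu j).add_smul (hf j) 1)
  have hR1 := entangledPolar_add_smul_right a b 1 hu hu hf
  have hR2 := entangledPolar_add_smul_right a b 1 hf hu hf
  simp only [one_mul, map_one] at hL hR1 hR2
  rw [← entangledPolar_self, hL, hR1, hR2, ← entangledPolar_self, ← entangledPolar_self]
  ring

/-- `Re m(u+f) = Re m(u) + Re m(f) + 2·Re P(u,f)`. [cite: Zhang2022LandauSiegel, Prop 7.1 p.44, (8.11)–(8.12)] -/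
theorem re_entangledMain_add {u u' f f' : Fin K → ℝ → ℂ} (hu : ∀ j, KinkedProfile (u j) (u' j))
    (hf : ∀ j, KinkedProfile (f j) (f' j)) :
    (entangledMain a b (fun j x => u j x + f j x) (fun j x => u' j x + f' j x)).re
      = (entangledMain a b u u').re + (entangledMain a b f f').re + 2 * (entangledPolar a b u u' f f').re := by
  rw [entangledMain_add hu hf, Complex.add_re, Complex.add_re, Complex.add_re, re_entangledPolar_swap a b u u' f f']
  ring

/-- **The entangled BULK form** `Σ_j Σ_l Re m₀(a,b_j,b_l)·T_{(a,b_j,b_l)}^{[0,1]}(S_j,T_l)` on vectors of tail-primitive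
data (`S, S′, S″`, `T, T′, T″` supplied per channel). Design data; nothing asserted.
[cite: Zhang2022LandauSiegel, Prop 7.1 p.44 with (8.11)–(8.23)] -/
def entangledBulk (a : ℝ) {K : ℕ} (b : Fin K → ℝ) (S S' S'' T T' T'' : Fin K → ℝ → ℂ) : ℂ :=
  ∑ j, ∑ l, (((ddM0 ![a, b j, b l]).re : ℝ) : ℂ)
    * bulkPolarOn ![a, b j, b l] 0 1 (S j) (S' j) (S'' j) (T l) (T' l) (T'' l)

/-- **The entangled FREE-END form** `Σ_j Σ_l F_{(a,b_j,b_l)}(x_j, y_l)` on jet vectors `x_j = (x₁ j, x₂ j)`,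
`y_l = (y₁ l, y₂ l)` — a `2K × 2K` Hermitian form (theory's «boundary coupling»). Design data; nothing asserted.
[cite: Zhang2022LandauSiegel, Prop 7.1 p.44 with (8.11)–(8.23)] -/
def entangledFreeEnd (a : ℝ) {K : ℕ} (b : Fin K → ℝ) (x₁ x₂ y₁ y₂ : Fin K → ℂ) : ℂ :=
  ∑ j, ∑ l, freeEndPolarDD ![a, b j, b l] (x₁ j) (x₂ j) (y₁ l) (y₂ l)

/-- **THE SUMMED IDENTITY (R3c):** for one-sided kinked profile vectors `h, k`,
`(π/2)·P(a;b)(h,k) = entangledBulk(S_h, S_k) + entangledFreeEnd(x_h, x_k)` with `S_{h,j} = tailPrim h_j`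
(`S′ = −h_j`, `S″ = −h_j′`) and jets `x_{h,j} = (∫₀¹h_j, −h_j(0))`.
[cite: Zhang2022LandauSiegel, Prop 7.1 p.44 with (7.2), (8.11)–(8.23)] -/
theorem entangledPolar_eq_bulk_add_freeEnd (a : ℝ) (b : Fin K → ℝ) (hh : ∀ j, KinkedProfile (h j) (h' j))
    (h1 : ∀ j, h j 1 = 0) (hk : ∀ j, KinkedProfile (k j) (k' j)) (k1 : ∀ j, k j 1 = 0) :
    ((π / 2 : ℝ) : ℂ) * entangledPolar a b h h' k k'
      = entangledBulk a b (fun j => tailPrim (h j)) (fun j y => -h j y) (fun j y => -h' j y)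
          (fun j => tailPrim (k j)) (fun j y => -k j y) (fun j y => -k' j y)
        + entangledFreeEnd a b (fun j => ∫ x in (0:ℝ)..1, h j x) (fun j => -h j 0)
          (fun j => ∫ x in (0:ℝ)..1, k j x) (fun j => -k j 0) := by
  unfold entangledPolar entangledBulk entangledFreeEnd
  rw [Finset.mul_sum, ← Finset.sum_add_distrib]
  refine Finset.sum_congr rfl fun j _ => ?_
  rw [Finset.mul_sum, ← Finset.sum_add_distrib]
  refine Finset.sum_congr rfl fun l _ => ?_
  exact formDetPolarDD_eq_bulkPolar_add_freeEndPolar _ (hh j) (hk l) (h1 j) (k1 l)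

/-- **The block main-term form decomposed:** `(π/2)·m(a;b;h) = entangledBulk(S_h,S_h) + entangledFreeEnd(x_h,x_h)`.
[cite: Zhang2022LandauSiegel, Prop 7.1 p.44 with (7.2), (8.11)–(8.23)] -/
theorem entangledMain_eq_bulk_add_freeEnd (a : ℝ) (b : Fin K → ℝ) (hh : ∀ j, KinkedProfile (h j) (h' j))
    (h1 : ∀ j, h j 1 = 0) :
    ((π / 2 : ℝ) : ℂ) * entangledMain a b h h'
      = entangledBulk a b (fun j => tailPrim (h j)) (fun j y => -h j y) (fun j y => -h' j y)
          (fun j => tailPrim (h j)) (fun j y => -h j y) (fun j y => -h' j y)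
        + entangledFreeEnd a b (fun j => ∫ x in (0:ℝ)..1, h j x) (fun j => -h j 0)
          (fun j => ∫ x in (0:ℝ)..1, h j x) (fun j => -h j 0) := by
  rw [← entangledPolar_self]
  exact entangledPolar_eq_bulk_add_freeEnd a b hh h1 hh h1

/-- The entangled free-end form vanishes against a zero jet vector. [cite: Zhang2022LandauSiegel, Prop 7.1 p.44 with (7.2)] -/
theorem entangledFreeEnd_zero_right (a : ℝ) (b : Fin K → ℝ) (x₁ x₂ : Fin K → ℂ) :
    entangledFreeEnd a b x₁ x₂ (fun _ => 0) (fun _ => 0) = 0 := by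
  simp [entangledFreeEnd, freeEndPolarDD_zero_right]

/-- **Against a SUB-CLASS test vector the pairing is pure bulk:** if `k_l(0) = 0 = ∫₀¹k_l` for all `l`, then
`(π/2)·P(a;b)(h,k) = entangledBulk(S_h, S_k)` — the first variation of R3a (Euler–Lagrange) is a bulk condition.
[cite: Zhang2022LandauSiegel, Prop 7.1 p.44 with (7.2), (8.11)–(8.23)] -/
theorem entangledPolar_eq_bulk_of_subclass (a : ℝ) (b : Fin K → ℝ) (hh : ∀ j, KinkedProfile (h j) (h' j))
    (h1 : ∀ j, h j 1 = 0) (hk : ∀ j, KinkedProfile (k j) (k' j)) (k1 : ∀ j, k j 1 = 0) (k0 : ∀ j, k j 0 = 0)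
    (kI : ∀ j, (∫ x in (0:ℝ)..1, k j x) = 0) :
    ((π / 2 : ℝ) : ℂ) * entangledPolar a b h h' k k'
      = entangledBulk a b (fun j => tailPrim (h j)) (fun j y => -h j y) (fun j y => -h' j y)
          (fun j => tailPrim (k j)) (fun j y => -k j y) (fun j y => -k' j y) := by
  rw [entangledPolar_eq_bulk_add_freeEnd a b hh h1 hk k1]
  have hx : (fun j => ∫ x in (0:ℝ)..1, k j x) = fun _ => (0:ℂ) := funext kI
  have hy : (fun j => -k j 0) = fun _ => (0:ℂ) := funext fun j => by rw [k0, neg_zero]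
  rw [hx, hy, entangledFreeEnd_zero_right, add_zero]

/-! ### Part 4 — the second-variation reduction of head 1 to jet extremals (theory's S3) -/

/-- **S3 — SECOND VARIATION.** Let `a ∈ (0,1]`, `b` any real palette, and `h`, `s` one-sided kinked profile vectors
with the SAME JETS (`h_j(0) = s_j(0)`, `∫₀¹h_j = ∫₀¹s_j`). If `s` is STATIONARY against the apex-and-mean-vanishing
sub-class (`Re P(a;b)(s,k) = 0` for every kinked `k` with `k_j(1) = k_j(0) = 0 = ∫k_j`), then
`Re m(a;b;s) ≤ Re m(a;b;h)`: `k = h − s` lies in the sub-class, `Re m(h) = Re m(s) + Re m(k) + 2Re P(s,k)`, and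
`Re m(k) ≥ 0` is the sub-class head (`Det.re_entangledMain_clamped_nonneg_unconditional`, p489266 ∘ L-B′1 p488885).
The Euler–Lagrange extremal of R3a is such an `s`; its existence is NOT asserted here.
[cite: Zhang2022LandauSiegel, Prop 7.1 p.44 with (7.2), (7.19)–(7.21), (8.11)–(8.23)] -/
theorem re_entangledMain_ge_of_firstVariation (ha : a ∈ Ioc (0:ℝ) 1) (b : Fin K → ℝ)
    (hh : ∀ j, KinkedProfile (h j) (h' j)) (h1 : ∀ j, h j 1 = 0)
    (hs : ∀ j, KinkedProfile (s j) (s' j)) (s1 : ∀ j, s j 1 = 0)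
    (hjet0 : ∀ j, h j 0 = s j 0) (hjetI : ∀ j, (∫ x in (0:ℝ)..1, h j x) = ∫ x in (0:ℝ)..1, s j x)
    (hvar : ∀ k k' : Fin K → ℝ → ℂ, (∀ j, KinkedProfile (k j) (k' j)) → (∀ j, k j 1 = 0) → (∀ j, k j 0 = 0) →
      (∀ j, (∫ x in (0:ℝ)..1, k j x) = 0) → (entangledPolar a b s s' k k').re = 0) :
    (entangledMain a b s s').re ≤ (entangledMain a b h h').re := by
  -- the difference `k = h − s` lies in the sub-class
  set k : Fin K → ℝ → ℂ := fun j x => h j x + (-1) * s j x with hk_def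
  set k' : Fin K → ℝ → ℂ := fun j x => h' j x + (-1) * s' j x with hk'_def
  have hk : ∀ j, KinkedProfile (k j) (k' j) := fun j => (hh j).add_smul (hs j) (-1)
  have k1 : ∀ j, k j 1 = 0 := fun j => by simp only [hk_def, h1 j, s1 j]; ring
  have k0 : ∀ j, k j 0 = 0 := fun j => by simp only [hk_def, hjet0 j]; ring
  have kI : ∀ j, (∫ x in (0:ℝ)..1, k j x) = 0 := by
    intro j
    have hhi : IntervalIntegrable (h j) volume 0 1 := (hh j).cont.intervalIntegrable_of_Icc zero_le_one
    have hsi : IntervalIntegrable (s j) volume 0 1 := (hs j).cont.intervalIntegrable_of_Icc zero_le_one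
    simp only [hk_def]
    rw [intervalIntegral.integral_add hhi (hsi.const_mul (-1)), intervalIntegral.integral_const_mul, hjetI j]
    ring
  -- `h = s + k`
  have he : (fun j x => s j x + k j x) = h := by funext j x; simp only [hk_def]; ring
  have he' : (fun j x => s' j x + k' j x) = h' := by funext j x; simp only [hk'_def]; ring
  have hexp := re_entangledMain_add (a := a) (b := b) hs hk
  rw [he, he'] at hexp
  have hsub : 0 ≤ (entangledMain a b k k').re := re_entangledMain_clamped_nonneg_unconditional ha b hk k1 k0 kI
  have hv : (entangledPolar a b s s' k k').re = 0 := hvar k k' hk k1 k0 kI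
  rw [hexp, hv]
  linarith

/-- **The interface one level above [K6] (head 1 from jet extremals):** if for EVERY jet datum
`(x₁, x₂) ∈ ℂ^K × ℂ^K` there is a one-sided kinked profile vector `s` with jets `(∫₀¹s_j, −s_j(0)) = (x₁ j, x₂ j)`,
stationary against the sub-class, and with `Re m(a;b;s) ≥ 0`, then `ConePSD a b` (`a ∈ (0,1]`). The hypothesis is
R3a's «m(a;b) ⪰ 0 evaluated on the Euler–Lagrange extremals»; nothing of it is asserted here.
[cite: Zhang2022LandauSiegel, Prop 7.1 p.44 with (7.2), (7.19)–(7.21), (8.11)–(8.23)] -/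
theorem conePSD_of_jetExtremals (ha : a ∈ Ioc (0:ℝ) 1) (b : Fin K → ℝ)
    (hE : ∀ x₁ x₂ : Fin K → ℂ, ∃ s s' : Fin K → ℝ → ℂ, (∀ j, KinkedProfile (s j) (s' j)) ∧ (∀ j, s j 1 = 0) ∧
      (∀ j, (∫ x in (0:ℝ)..1, s j x) = x₁ j) ∧ (∀ j, -s j 0 = x₂ j) ∧
      (∀ k k' : Fin K → ℝ → ℂ, (∀ j, KinkedProfile (k j) (k' j)) → (∀ j, k j 1 = 0) → (∀ j, k j 0 = 0) →
        (∀ j, (∫ x in (0:ℝ)..1, k j x) = 0) → (entangledPolar a b s s' k k').re = 0) ∧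
      0 ≤ (entangledMain a b s s').re) :
    ConePSD a b := by
  intro h h' hh h1
  obtain ⟨s, s', hs, s1, sI, s0, hvar, hpos⟩ := hE (fun j => ∫ x in (0:ℝ)..1, h j x) (fun j => -h j 0)
  have hjet0 : ∀ j, h j 0 = s j 0 := fun j => by have := s0 j; simp only [neg_inj] at this; exact this.symm
  have hjetI : ∀ j, (∫ x in (0:ℝ)..1, h j x) = ∫ x in (0:ℝ)..1, s j x := fun j => (sI j).symm
  exact hpos.trans (re_entangledMain_ge_of_firstVariation ha b hh h1 hs s1 hjet0 hjetI hvar)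

/-- **«`ConePSD a b ⟺ m(a;b) ⪰ 0`» with the extremals displayed (theory (C), S1–S2 as hypothesis):** if every jet
datum admits a one-sided kinked stationary profile vector (extremal EXISTENCE, R3a's S1+S2), then head 1 at `(a,b)`
holds iff every stationary one-sided kinked profile vector has non-negative energy.
[cite: Zhang2022LandauSiegel, Prop 7.1 p.44 with (7.2), (7.19)–(7.21), (8.11)–(8.23)] -/
theorem conePSD_iff_extremals_nonneg (ha : a ∈ Ioc (0:ℝ) 1) (b : Fin K → ℝ)
    (hS : ∀ x₁ x₂ : Fin K → ℂ, ∃ s s' : Fin K → ℝ → ℂ, (∀ j, KinkedProfile (s j) (s' j)) ∧ (∀ j, s j 1 = 0) ∧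
      (∀ j, (∫ x in (0:ℝ)..1, s j x) = x₁ j) ∧ (∀ j, -s j 0 = x₂ j) ∧
      (∀ k k' : Fin K → ℝ → ℂ, (∀ j, KinkedProfile (k j) (k' j)) → (∀ j, k j 1 = 0) → (∀ j, k j 0 = 0) →
        (∀ j, (∫ x in (0:ℝ)..1, k j x) = 0) → (entangledPolar a b s s' k k').re = 0)) :
    ConePSD a b ↔
      ∀ s s' : Fin K → ℝ → ℂ, (∀ j, KinkedProfile (s j) (s' j)) → (∀ j, s j 1 = 0) →
        (∀ k k' : Fin K → ℝ → ℂ, (∀ j, KinkedProfile (k j) (k' j)) → (∀ j, k j 1 = 0) → (∀ j, k j 0 = 0) →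
          (∀ j, (∫ x in (0:ℝ)..1, k j x) = 0) → (entangledPolar a b s s' k k').re = 0) →
        0 ≤ (entangledMain a b s s').re := by
  refine ⟨fun hP s s' hs s1 _ => hP s s' hs s1, fun hpos => conePSD_of_jetExtremals ha b fun x₁ x₂ => ?_⟩
  obtain ⟨s, s', hs, s1, sI, s0, hvar⟩ := hS x₁ x₂
  exact ⟨s, s', hs, s1, sI, s0, hvar, hpos s s' hs s1 hvar⟩

end Entangled

end Det

end Literature.NumberTheory.LFunctions.Zhang2022
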